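import Summits.BirchSwinnertonDyer.Rank1Residual.ManinAdditive.TwistOrbitDegreeIdentity
import Literature.NumberTheory.EllipticCurves.ManinConstantQuadraticTwistAtTwoProofs
import HarnessLib

/-!
# Twist-orbit transport of the Manin constant — FILE 3/3: THEOREM A at `(q*, q, q²)` KERNEL-CHECKED
# (`twistOrbitManinTransport_pStar`), the commuting chain (THM III core), E-an-16/15/15v instances, and the
# g2 edges instantiated: THM II (`flipOrbitManinEq_pStar`) outright, THM III (`orbitManinDefectLeOne_pStar`)
# modulo Pal's dichotomy

Part of the planner `bsd-f2-manin-an`'s kernel-checked HOME/an/Sketch-an4v5.lean 2d253c8874352f93 (§§7–8),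
landed verbatim by the cell's typer (T-an-6); see `TwistOrbitManinStatements.lean` for provenance. PROVED,
no `sorry`, no conjecture tags; the printed inputs ČNS Thm 1.2 (`cesnaviciusNeururerSaha_thm_1_2`) and Pal's
dichotomy (`PalTwistDichotomy`) enter only as explicit hypotheses where stated.
-/

noncomputable section

open scoped MatrixGroups ModularForm

open CongruenceSubgroup WeierstrassCurve
  Literature.NumberTheory.DiophantineGeometry
  Literature.NumberTheory.EllipticCurves
  Literature.NumberTheory.EllipticCurves.ModularForms

namespace Summit.BirchSwinnertonDyer.Rank1Residual.ManinAdditive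
/-! ## §7 (g3 v4). THEOREM A at the same-level orbit `(q*, q, q²)` — KERNEL-CHECKED.

E-an-9 `TwistOrbitManinTransport q* q q²` (both clauses), E-an-12c `CommutingOrbitManinChain q* q q²`,
hence E-an-16 `ManinEqOfNotDvdDegree q* q q²` OUTRIGHT, and E-an-15 / E-an-15v at `(q*, q²)` modulo the
printed ČNS Thm 1.2 ONLY (`cesnaviciusNeururerSaha_thm_1_2`, a named Literature fact).  The engine is the
tree's `Γ₀` lattice chain `maninConstant_dvd_of_charTwist_gamma0` (Stevens 1989 (5.4) on `Γ₀` + the Néron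
mapping property `integral_neronScaling_of_isGloballyMinimal_holds`); the ONLY new input is the Néron
lattice of the twist-minimal member's partner: `Δ(C) = d⁶ Δ(W)` forces `u = ±1`, so
`Λ_C = g(χ)⁻¹ Λ_W` (`g(χ)² = q* = d`) — the rôle Stevens' Lemma (5.2) plays for a SEMISTABLE partner
(`stevens1989_neronLattice_quadraticTwist_oddPrime_holds`) is played here, for an ADDITIVE partner, by
twist-minimality.  For the bit direction (`ũ = q`) the chain is re-run with an integer factor `r`
(`maninConstant_dvd_mul_of_charTwist_gamma0`). -/

section ThmA

variable {q : ℕ}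

/-- `(u.u)² = r²` when `u • (W ⊗ χ_d) = C` and `r¹² Δ(C) = d⁶ Δ(W)`. [folklore] -/
theorem u_sq_eq_sq_of_smul_quadraticTwist_of_Δ {W C : WeierstrassCurve ℚ} [W.IsElliptic]
    {d : ℚ} (hd : d ≠ 0) {r : ℚ} (u : VariableChange ℚ) (hu : u • W.quadraticTwist d = C)
    (hΔ : r ^ 12 * C.Δ = d ^ 6 * W.Δ) : ((u.u : ℚ)) ^ 2 = r ^ 2 := by
  have h1 : C.Δ = ((u.u⁻¹ : ℚˣ) : ℚ) ^ 12 * (d ^ 6 * W.Δ) := by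
    rw [← hu, variableChange_Δ, quadraticTwist_Δ]
  have hX : d ^ 6 * W.Δ ≠ 0 := mul_ne_zero (pow_ne_zero _ hd) W.isUnit_Δ.ne_zero
  have h12 : (r * ((u.u⁻¹ : ℚˣ) : ℚ)) ^ 12 = 1 := by
    have h := hΔ
    rw [h1, ← mul_assoc, ← mul_pow] at h
    exact mul_right_cancel₀ hX (h.trans (one_mul _).symm)
  have h6 : ((r * ((u.u⁻¹ : ℚˣ) : ℚ)) ^ 2) ^ 6 = 1 := by rw [← pow_mul]; exact h12
  have h2 : (r * ((u.u⁻¹ : ℚˣ) : ℚ)) ^ 2 = 1 :=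
    (pow_eq_one_iff_of_nonneg (sq_nonneg _) (by norm_num)).mp h6
  rw [Units.val_inv_eq_inv_val, mul_pow, inv_pow,
    mul_inv_eq_one₀ (pow_ne_zero _ (Units.ne_zero u.u))] at h2
  exact h2.symm

/-- **The Néron lattice along a `χ_{q*}`-twist with defect `r`: `Λ_C = ± r g(χ)⁻¹ Λ_W`.** If
`u • (W ⊗ χ_{q*}) = C` and `r¹² Δ(C) = (q*)⁶ Δ(W)` (`r = 1`: `W` twist-minimal; `r = q`: the other
side), then `z ∈ Λ_C ↔ g(χ) r⁻¹ z ∈ Λ_W` for any Néron-type pairs of `W`, `C` (`u.u = ±r`,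
`g(χ)² = q*`). No minimality or reduction hypothesis. [cite: Pal2012, Lemma 3.1]
[cite: Stevens1989, Lemma (5.2) p. 96 (the semistable analogue)] -/
theorem neronLattice_mem_iff_of_twist_pStar [Fact q.Prime] {W C : WeierstrassCurve ℚ} [W.IsElliptic]
    (hq2 : q ≠ 2) (u : VariableChange ℚ)
    (hu : u • W.quadraticTwist (((-1 : ℤ) ^ (q / 2) * q : ℤ) : ℚ) = C) {r : ℚ}
    (hΔ : r ^ 12 * C.Δ = ((((-1 : ℤ) ^ (q / 2) * q : ℤ)) : ℚ) ^ 6 * W.Δ)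
    {L LC : PeriodPair} (hL : IsNeronLatticeOf (W.baseChange ℂ) L)
    (hLC : IsNeronLatticeOf (C.baseChange ℂ) LC) (z : ℂ) :
    z ∈ LC.lattice ↔
      gaussSum ((quadraticChar (ZMod q)).ringHomComp (Int.castRingHom ℂ)) (ZMod.stdAddChar (N := q)) *
        (((r : ℚ) : ℂ)⁻¹ * z) ∈ L.lattice := by
  set d : ℤ := (-1 : ℤ) ^ (q / 2) * q with hd
  set G : ℂ := gaussSum ((quadraticChar (ZMod q)).ringHomComp (Int.castRingHom ℂ))
    (ZMod.stdAddChar (N := q)) with hGdef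
  have hq : q.Prime := Fact.out
  have hdZ : d ≠ 0 := mul_ne_zero (pow_ne_zero _ (by norm_num)) (by exact_mod_cast hq.ne_zero)
  have hd0 : (d : ℚ) ≠ 0 := by exact_mod_cast hdZ
  have hG2 : G ^ 2 = ((d : ℚ) : ℂ) := by
    rw [hGdef, gaussSum_quadraticChar_ringHomComp_sq q hq2, hd]
    push_cast
    ring
  have hG0 : G ≠ 0 := by
    intro h0
    have : ((d : ℚ) : ℂ) = 0 := by rw [← hG2, h0]; simp
    exact hd0 (by exact_mod_cast this)
  have hLT : IsNeronLatticeOf ((W.quadraticTwist (d : ℚ)).baseChange ℂ)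
      (L.mulLeft G⁻¹ (inv_ne_zero hG0)) :=
    WeierstrassCurve.isNeronLatticeOf_quadraticTwist_of_sq_eq (d : ℚ) hL hG0 hG2
  have hLC' : IsNeronLatticeOf ((u • W.quadraticTwist (d : ℚ)).baseChange ℂ) LC := by
    rw [hu]; exact hLC
  have hlat := IsNeronLatticeOf.lattice_eq_mulLeft_of_smul u hLT hLC'
  have hu2 : ((u.u : ℚ)) ^ 2 = r ^ 2 := u_sq_eq_sq_of_smul_quadraticTwist_of_Δ hd0 u hu hΔ
  have hU : (u.u : ℚ) = r ∨ (u.u : ℚ) = -r := sq_eq_sq_iff_eq_or_eq_neg.mp hu2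
  rw [hlat, PeriodPair.mem_mulLeft_lattice, PeriodPair.mem_mulLeft_lattice, inv_inv]
  rcases hU with h1 | h1
  · rw [h1]
  · rw [h1, Rat.cast_neg, inv_neg, show G * (-((r : ℚ) : ℂ)⁻¹ * z) = -(G * ((((r : ℚ) : ℂ))⁻¹ * z))
      by ring, neg_mem_iff]

/-- **The coefficient relation `aₙ(f_{W'}) = χ(n) aₙ(f_W)` along the orbit** (`C = u • (W ⊗ χ_{q*})`,
`L(C) = L(W')`, `W'` additive at `q`). [cite: Stevens1989, (5.5) p. 97] -/
theorem cuspCoeff_eq_chi_mul_of_twist_pStar [Fact q.Prime] {W W' C : WeierstrassCurve ℚ}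
    [W.IsElliptic] [W'.IsElliptic] {N N' : ℕ} [NeZero N] [NeZero N'] (hq2 : q ≠ 2)
    (u : VariableChange ℚ) (hu : u • W.quadraticTwist (((-1 : ℤ) ^ (q / 2) * q : ℤ) : ℚ) = C)
    (hLC : C.LFunction = W'.LFunction) (hW'0 : ∀ n : ℕ, q ∣ n → W'.LFunction n = 0)
    (D : ModularParametrizationData W N) (D' : ModularParametrizationData W' N') (n : ℕ) :
    cuspCoeff D'.f n =
      (quadraticChar (ZMod q)).ringHomComp (Int.castRingHom ℂ) n * cuspCoeff D.f n := by
  have hq : q.Prime := Fact.out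
  have hdZ : ((-1 : ℤ) ^ (q / 2) * q : ℤ) ≠ 0 :=
    mul_ne_zero (pow_ne_zero _ (by norm_num)) (by exact_mod_cast hq.ne_zero)
  have hd0 : ((((-1 : ℤ) ^ (q / 2) * q : ℤ)) : ℚ) ≠ 0 := by exact_mod_cast hdZ
  haveI := W.isElliptic_quadraticTwist hd0
  rw [D'.isNewformOf.2 n, D.isNewformOf.2 n, quadraticChar_ringHomComp_apply_natCast q n]
  by_cases hqn : q ∣ n
  · have h0 : legendreSym q n = 0 :=
      (legendreSym.eq_zero_iff q n).mpr (by exact_mod_cast (ZMod.natCast_eq_zero_iff n q).mpr hqn)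
    rw [hW'0 n hqn, h0]
    push_cast
    ring
  · rw [← hLC, ← hu, LFunction_smul, W.LFunction_quadraticTwist_pStar_apply hq2 hqn]
    push_cast
    rfl

/-- The same relation read backwards: `aₙ(f_W) = χ(n) aₙ(f_{W'})` (`χ² = 1` off `q`, both sides `0`
at `q ∣ n` since `W` is additive at `q` too). [cite: Stevens1989, (5.5) p. 97] -/
theorem cuspCoeff_eq_chi_mul_of_twist_pStar' [Fact q.Prime] {W W' C : WeierstrassCurve ℚ}
    [W.IsElliptic] [W'.IsElliptic] {N N' : ℕ} [NeZero N] [NeZero N'] (hq2 : q ≠ 2)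
    (u : VariableChange ℚ) (hu : u • W.quadraticTwist (((-1 : ℤ) ^ (q / 2) * q : ℤ) : ℚ) = C)
    (hLC : C.LFunction = W'.LFunction) (hW0 : ∀ n : ℕ, q ∣ n → W.LFunction n = 0)
    (D : ModularParametrizationData W N) (D' : ModularParametrizationData W' N') (n : ℕ) :
    cuspCoeff D.f n =
      (quadraticChar (ZMod q)).ringHomComp (Int.castRingHom ℂ) n * cuspCoeff D'.f n := by
  have hq : q.Prime := Fact.out
  have hdZ : ((-1 : ℤ) ^ (q / 2) * q : ℤ) ≠ 0 :=
    mul_ne_zero (pow_ne_zero _ (by norm_num)) (by exact_mod_cast hq.ne_zero)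
  have hd0 : ((((-1 : ℤ) ^ (q / 2) * q : ℤ)) : ℚ) ≠ 0 := by exact_mod_cast hdZ
  haveI := W.isElliptic_quadraticTwist hd0
  rw [D'.isNewformOf.2 n, D.isNewformOf.2 n, quadraticChar_ringHomComp_apply_natCast q n]
  by_cases hqn : q ∣ n
  · have h0 : legendreSym q n = 0 :=
      (legendreSym.eq_zero_iff q n).mpr (by exact_mod_cast (ZMod.natCast_eq_zero_iff n q).mpr hqn)
    rw [hW0 n hqn, h0]
    push_cast
    ring
  · rw [← hLC, ← hu, LFunction_smul, W.LFunction_quadraticTwist_pStar_apply hq2 hqn]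
    have hne : ((n : ℤ) : ZMod q) ≠ 0 := by
      rw [Int.cast_natCast, Ne, ZMod.natCast_eq_zero_iff]
      exact hqn
    have hsq : ((legendreSym q n : ℤ) : ℂ) ^ 2 = 1 := by exact_mod_cast legendreSym.sq_one q hne
    push_cast
    rw [← mul_assoc, ← sq, hsq, one_mul]

/-- **The `Γ₀` lattice chain with an integer factor `r`: `c(D) ∣ r · c(D')`.** Verbatim the tree's
`maninConstant_dvd_of_charTwist_gamma0` (Stevens (5.4) on `Γ₀` + Néron mapping property) except that the
Néron lattice of `C` is only assumed to CONTAIN `r g(χ)⁻¹ Λ_A` (one inclusion, scaled by `r ∈ ℤ`):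
`z = c w ∈ Λ_W`, `g(χ) w ∈ Λ(f_{D'})`, `c' g(χ) w ∈ Λ_A` ⟹ `r c' w ∈ Λ_C`, so `(r c'/c) Λ_W ⊆ Λ_C` and
`r c'/c ∈ ℤ`. [cite: Stevens1989, Lemma (5.4) p. 97 and (2.8) p. 88]
[cite: SilvermanATAEC1994, IV.5.1 with IV.6.1 and Cor. IV.9.1] -/
theorem maninConstant_dvd_mul_of_charTwist_gamma0 {A : WeierstrassCurve ℚ} {N' : ℕ} [NeZero N']
    {W : WeierstrassCurve ℚ} [W.IsElliptic] [W.IsGloballyMinimal] {N : ℕ} [NeZero N]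
    {m : ℕ} [NeZero m] {χ : DirichletCharacter ℂ m}
    {C : WeierstrassCurve ℚ} [C.IsElliptic] [C.IsGloballyMinimal] {LC : PeriodPair}
    (D' : ModularParametrizationData A N') (D : ModularParametrizationData W N)
    (h : ∀ z ∈ D.L.lattice, ∃ w ∈ periodLattice D.f, z = D.c * w)
    (hχ : χ.IsQuadratic) (hprim : χ.IsPrimitive) (hN : N' ∣ N) (hm : m ^ 2 ∣ N)
    (hf : ∀ n : ℕ, cuspCoeff D.f n = χ n * cuspCoeff D'.f n)
    (hC : IsNeronLatticeOf (C.baseChange ℂ) LC) (r : ℤ)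
    (hLC : ∀ z : ℂ, gaussSum χ (ZMod.stdAddChar (N := m)) * z ∈ D'.L.lattice →
      (r : ℂ) * z ∈ LC.lattice) :
    D.c ∣ r * D'.c := by
  set G : ℂ := gaussSum χ (ZMod.stdAddChar (N := m)) with hG
  have hfeq : D.f = charTwist N hN hm hχ D'.f :=
    eq_of_forall_cuspCoeff_eq_gamma0 fun n ↦ by rw [hf, cuspCoeff_charTwist N hN hm hχ hprim]
  have hc : D.c ≠ 0 := D.maninConstant_ne_zero_holds
  have key : ∀ z ∈ D.L.lattice, ((((r * D'.c : ℚ) / D.c : ℚ)) : ℂ) * z ∈ LC.lattice := by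
    intro z hz
    obtain ⟨w, hw, rfl⟩ := h z hz
    have hw' : G * w ∈ periodLattice D'.f := by
      rw [hfeq] at hw
      exact gaussSum_mul_mem_periodLattice_of_mem_charTwist N hN hm hχ hprim D'.f hw
    have h3 : (D'.c : ℂ) * (G * w) ∈ D'.L.lattice := D'.smul_periodLattice_le _ hw'
    have h4 : (r : ℂ) * ((D'.c : ℂ) * w) ∈ LC.lattice :=
      hLC _ (by rw [show G * ((D'.c : ℂ) * w) = (D'.c : ℂ) * (G * w) by ring]; exact h3)
    have hcℂ : (D.c : ℂ) ≠ 0 := by exact_mod_cast hc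
    convert h4 using 1
    push_cast
    field_simp
  obtain ⟨k, hk⟩ :=
    integral_neronScaling_of_isGloballyMinimal_holds W C D.L LC D.isNeronLattice hC _ key
  have hcℚ : (D.c : ℚ) ≠ 0 := by exact_mod_cast hc
  have h' : ((r : ℚ) * D'.c : ℚ) = D.c * k := by
    rw [hk]
    field_simp
  exact ⟨k, by exact_mod_cast h'⟩

/-- **E-an-9 at `(q*, q, q²)` is a THEOREM: `TwistOrbitManinTransport q* q q²`** for every odd prime `q`.
Clause 1 (`ũ = 1`): the tree's `maninConstant_dvd_of_charTwist_gamma0` with `Λ_C = g(χ)⁻¹ Λ_W`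
(`neronLattice_mem_iff_of_twist_pStar`, `r = 1`).  Clause 2 (`ũ = q`): the factor-`r` chain with
`Λ_C = ± q g(χ)⁻¹ Λ_W`.  [cite: Stevens1989, Lemmas (5.2), (5.4)] [cite: Pal2012, Lemma 3.1]
[cite: SilvermanATAEC1994, Cor. IV.9.1] -/
theorem twistOrbitManinTransport_pStar (hq : q.Prime) (hq2 : q ≠ 2) :
    TwistOrbitManinTransport ((-1 : ℤ) ^ (q / 2) * q) q (q ^ 2) := by
  intro W W' C _ _ _ _ _ _ _ _ u D D' hM hN hu hiso hD'
  haveI : Fact q.Prime := ⟨hq⟩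
  haveI : NeZero q := ⟨hq.ne_zero⟩
  have hM' : q ^ 2 ∣ W'.conductorNorm ℤ := by rw [hN]; exact hM
  obtain ⟨hngW', hnmW'⟩ := not_good_and_not_mult_of_sq_dvd_conductorNorm W' hM'
  have hW'0 : ∀ n : ℕ, q ∣ n → W'.LFunction n = 0 := fun n hn ↦
    W'.LFunction_apply_eq_zero_of_not_good_of_not_mult q hngW' hnmW' hn
  have hcoef := fun n ↦
    cuspCoeff_eq_chi_mul_of_twist_pStar hq2 u hu hiso.LFunction_eq hW'0 D D' n
  haveI : (C.baseChange ℂ).IsElliptic := by rw [WeierstrassCurve.baseChange]; infer_instance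
  obtain ⟨LC, hLC⟩ := exists_isNeronLatticeOf_holds (C.baseChange ℂ)
  have hNdvd : W.conductorNorm ℤ ∣ W'.conductorNorm ℤ := by rw [hN]
  have hχq := isQuadratic_quadraticChar_ringHomComp q
  have hχp := isPrimitive_quadraticChar_ringHomComp q hq2
  refine ⟨fun hΔ ↦ ?_, fun hΔ ↦ ?_⟩
  · have hΔ1 : (1 : ℚ) ^ 12 * C.Δ = ((((-1 : ℤ) ^ (q / 2) * q : ℤ)) : ℚ) ^ 6 * W.Δ := by
      rw [one_pow, one_mul]; exact hΔ
    have hmem : ∀ z : ℂ, z ∈ LC.lattice ↔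
        gaussSum ((quadraticChar (ZMod q)).ringHomComp (Int.castRingHom ℂ))
          (ZMod.stdAddChar (N := q)) * z ∈ D.L.lattice := fun z ↦ by
      simpa using neronLattice_mem_iff_of_twist_pStar hq2 u hu hΔ1 D.isNeronLattice hLC z
    exact maninConstant_dvd_of_charTwist_gamma0 D D' hD' hχq hχp hNdvd hM' hcoef hLC hmem
  · have hΔq : (q : ℚ) ^ 12 * C.Δ = ((((-1 : ℤ) ^ (q / 2) * q : ℤ)) : ℚ) ^ 6 * W.Δ := hΔ
    have hq0 : (q : ℂ) ≠ 0 := by exact_mod_cast hq.ne_zero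
    have hmem : ∀ z : ℂ,
        gaussSum ((quadraticChar (ZMod q)).ringHomComp (Int.castRingHom ℂ))
          (ZMod.stdAddChar (N := q)) * z ∈ D.L.lattice → ((q : ℤ) : ℂ) * z ∈ LC.lattice := by
      intro z hz
      rw [neronLattice_mem_iff_of_twist_pStar hq2 u hu hΔq D.isNeronLattice hLC]
      convert hz using 2
      push_cast
      rw [← mul_assoc, inv_mul_cancel₀ hq0, one_mul]
    exact maninConstant_dvd_mul_of_charTwist_gamma0 D D' hD' hχq hχp hNdvd hM' hcoef hLC (q : ℤ) hmem

/-- **E-an-12c at `(q*, q, q²)` is a THEOREM: `CommutingOrbitManinChain q* q q²`** (`c' ∣ c ∣ q c'` on a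
commuting orbit, `W` twist-minimal, both data lattice-optimal).  Clause 1 = clause 1 of E-an-9 with
`C = W'`; clause 2 = the factor-`r` chain run BACKWARDS (`W` optimal, `A = W'`, `C = W`, `r = q*`:
`g(χ) z ∈ Λ_{W'} = g(χ)⁻¹ Λ_W ⟹ q* z ∈ Λ_W`). [cite: Stevens1989, Lemma (5.4)] [cite: Pal2012, Lemma 3.1] -/
theorem commutingOrbitManinChain_pStar (hq : q.Prime) (hq2 : q ≠ 2) :
    CommutingOrbitManinChain ((-1 : ℤ) ^ (q / 2) * q) q (q ^ 2) := by
  intro W W' _ _ _ _ _ _ u D D' hM hN hu hD hD' hΔ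
  haveI : Fact q.Prime := ⟨hq⟩
  haveI : NeZero q := ⟨hq.ne_zero⟩
  set d : ℤ := (-1 : ℤ) ^ (q / 2) * q with hd
  have hM' : q ^ 2 ∣ W'.conductorNorm ℤ := by rw [hN]; exact hM
  obtain ⟨hngW, hnmW⟩ := not_good_and_not_mult_of_sq_dvd_conductorNorm W hM
  obtain ⟨hngW', hnmW'⟩ := not_good_and_not_mult_of_sq_dvd_conductorNorm W' hM'
  have hW0 : ∀ n : ℕ, q ∣ n → W.LFunction n = 0 := fun n hn ↦
    W.LFunction_apply_eq_zero_of_not_good_of_not_mult q hngW hnmW hn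
  have hW'0 : ∀ n : ℕ, q ∣ n → W'.LFunction n = 0 := fun n hn ↦
    W'.LFunction_apply_eq_zero_of_not_good_of_not_mult q hngW' hnmW' hn
  have hχq := isQuadratic_quadraticChar_ringHomComp q
  have hχp := isPrimitive_quadraticChar_ringHomComp q hq2
  have hNdvd : W.conductorNorm ℤ ∣ W'.conductorNorm ℤ := by rw [hN]
  have hNdvd' : W'.conductorNorm ℤ ∣ W.conductorNorm ℤ := by rw [hN]
  have hΔ1 : (1 : ℚ) ^ 12 * W'.Δ = ((d : ℤ) : ℚ) ^ 6 * W.Δ := by rw [one_pow, one_mul]; exact hΔ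
  have hmem : ∀ z : ℂ, z ∈ D'.L.lattice ↔
      gaussSum ((quadraticChar (ZMod q)).ringHomComp (Int.castRingHom ℂ))
        (ZMod.stdAddChar (N := q)) * z ∈ D.L.lattice := fun z ↦ by
    simpa using neronLattice_mem_iff_of_twist_pStar hq2 u hu hΔ1 D.isNeronLattice D'.isNeronLattice z
  refine ⟨?_, ?_⟩
  · have hcoef := fun n ↦ cuspCoeff_eq_chi_mul_of_twist_pStar hq2 u hu rfl hW'0 D D' n
    exact maninConstant_dvd_of_charTwist_gamma0 D D' hD' hχq hχp hNdvd hM' hcoef D'.isNeronLattice hmem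
  · have hcoef' := fun n ↦ cuspCoeff_eq_chi_mul_of_twist_pStar' hq2 u hu rfl hW0 D D' n
    have hG2 := gaussSum_quadraticChar_ringHomComp_sq q hq2
    have hmem' : ∀ z : ℂ,
        gaussSum ((quadraticChar (ZMod q)).ringHomComp (Int.castRingHom ℂ))
          (ZMod.stdAddChar (N := q)) * z ∈ D'.L.lattice → ((d : ℤ) : ℂ) * z ∈ D.L.lattice := by
      intro z hz
      have h2 := (hmem _).mp hz
      rw [← mul_assoc, ← sq, hG2] at h2
      exact h2
    have h2 : D.c ∣ d * D'.c :=
      maninConstant_dvd_mul_of_charTwist_gamma0 D' D hD hχq hχp hNdvd' hM hcoef' D.isNeronLattice d hmem'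
    rcases neg_one_pow_eq_or ℤ (q / 2) with h1 | h1
    · simpa [hd, h1] using h2
    · have : d = -q := by rw [hd, h1]; ring
      rw [this, neg_mul, dvd_neg] at h2
      exact h2

/-- **E-an-16 at `(q*, q, q²)` OUTRIGHT**: on a commuting same-level `χ_{q*}`-orbit with `W` twist-minimal
and `q ∤ deg φ_W`: `c' = ±c` and `deg φ_{W'} = q · deg φ_W`. [cite: Watkins2002, §2.1]
[cite: Stevens1989, Lemmas (5.2), (5.4)] -/
theorem maninEqOfNotDvdDegree_pStar_holds (hq : q.Prime) (hq2 : q ≠ 2) :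
    ManinEqOfNotDvdDegree ((-1 : ℤ) ^ (q / 2) * q) q (q ^ 2) :=
  maninEqOfNotDvdDegree_pStar hq hq2 (commutingOrbitManinChain_pStar hq hq2)

/-- `(−3, 3, 9)`: the `III ↔ III*` orbits at `9 ‖ N`. -/
theorem maninEqOfNotDvdDegree_neg_three_holds : ManinEqOfNotDvdDegree (-3) 3 9 :=
  maninEqOfNotDvdDegree_pStar_holds (q := 3) (by norm_num) (by norm_num)

/-- `(5, 5, 25)`. -/
theorem maninEqOfNotDvdDegree_five_holds : ManinEqOfNotDvdDegree 5 5 25 :=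
  maninEqOfNotDvdDegree_pStar_holds (q := 5) (by norm_num) (by norm_num)

/-- `(−7, 7, 49)`. -/
theorem maninEqOfNotDvdDegree_neg_seven_holds : ManinEqOfNotDvdDegree (-7) 7 49 :=
  maninEqOfNotDvdDegree_pStar_holds (q := 7) (by norm_num) (by norm_num)

/-- **E-an-15v at `(q*, q²)` modulo the printed ČNS Thm 1.2 only.** [cite: CesnaviciusNeururerSaha2023, Thm. 1.2] -/
theorem twistPartnerDegreeBound_pStar (hq : q.Prime) (hq2 : q ≠ 2)
    (hCNS : cesnaviciusNeururerSaha_thm_1_2) :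
    TwistPartnerDegreeBound ((-1 : ℤ) ^ (q / 2) * q) (q ^ 2) :=
  twistPartnerDegreeBound_of_transport _ q _ (twistOrbitManinTransport_pStar hq hq2) hCNS

/-- **E-an-15 at `(q*, q²)` modulo the printed ČNS Thm 1.2 only** — the census-bearing statement
(`p ∤ deg φ` at the twist-minimal member and `ε_p(N) = 0` ⟹ `p ∤ c` of the PARTNER's optimal curve):
12 414 / 49 167 / 34 739 classes at `p = 3 / 5 / 7` in Cremona's table beyond ČNS applied directly.
[cite: CesnaviciusNeururerSaha2023, Thm. 1.2] [cite: Stevens1989, Lemmas (5.2), (5.4)] -/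
theorem twistMinimalDegreeRoadTransport_pStar (hq : q.Prime) (hq2 : q ≠ 2)
    (hCNS : cesnaviciusNeururerSaha_thm_1_2) :
    TwistMinimalDegreeRoadTransport ((-1 : ℤ) ^ (q / 2) * q) (q ^ 2) :=
  twistMinimalDegreeRoadTransport_of_transport _ q _ (twistOrbitManinTransport_pStar hq hq2) hCNS

/-- `(−3, 9)` instance. -/
theorem twistMinimalDegreeRoadTransport_neg_three (hCNS : cesnaviciusNeururerSaha_thm_1_2) :
    TwistMinimalDegreeRoadTransport (-3) 9 :=
  twistMinimalDegreeRoadTransport_pStar (q := 3) (by norm_num) (by norm_num) hCNS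

end ThmA

section G2EdgesInstances

/-- **THM II at `(q*, q, q²)` OUTRIGHT**: on a same-level flip orbit (both optimal curves twist-minimal) `c′ = ±c`.
[cite: Stevens1989, Lemmas (5.2), (5.4)] [cite: Pal2012, Lemma 3.1] -/
theorem flipOrbitManinEq_pStar {q : ℕ} (hq : q.Prime) (hq2 : q ≠ 2) :
    FlipOrbitManinEq ((-1 : ℤ) ^ (q / 2) * q) q (q ^ 2) :=
  flipOrbitManinEq_of_transport _ q _ (twistOrbitManinTransport_pStar hq hq2)

/-- **THM III at `(q*, q, q²)` modulo Pal's twist dichotomy (S-an-11, in print: Pal 2012 Prop. 2.5)**: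
`c′ ∣ q·c ∧ c ∣ q·c′` on every same-conductor `χ_{q*}`-orbit of optimal curves. [cite: Pal2012, Prop. 2.5]
[cite: Stevens1989, Lemmas (5.2), (5.4)] -/
theorem orbitManinDefectLeOne_pStar {q : ℕ} (hq : q.Prime) (hq2 : q ≠ 2)
    (hP : PalTwistDichotomy ((-1 : ℤ) ^ (q / 2) * q) q (q ^ 2)) :
    OrbitManinDefectLeOne ((-1 : ℤ) ^ (q / 2) * q) q (q ^ 2) :=
  orbitManinDefectLeOne_of_transport _ q _ (twistOrbitManinTransport_pStar hq hq2) hP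

/-- `(−3, 3, 9)` flip orbits (21 770 ordered pairs in Cremona's table): `c′ = ±c`, no hypothesis. -/
theorem flipOrbitManinEq_neg_three : FlipOrbitManinEq (-3) 3 9 :=
  flipOrbitManinEq_pStar (q := 3) (by norm_num) (by norm_num)


end G2EdgesInstances

end Summit.BirchSwinnertonDyer.Rank1Residual.ManinAdditive

end
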